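import Literature.Computability.Complexity.CNF
import Literature.Computability.Complexity.HashBricks
import Literature.Computability.Complexity.PRelHierarchy
import Literature.Computability.Complexity.StackMachines
import HarnessLib

/-!
# Reading a CNF code token by token in polynomial time (the tokenizer of Karp's `SAT ∝ CLIQUE` map)

Trunk `FP`-algebra toolkit (no machine is written). Karp's reduction `SATISFIABILITY ∝ CLIQUE`
(Karp 1972, §4: "`N = {⟨σ, i⟩ | σ is a literal and occurs in Cᵢ}` …") and every other map out of
`SAT` that works occurrence by occurrence needs the literal occurrences of a CNF code
`encodingCNF.encode φ` (`CNF.lean`: unary clause-count header, then the `listBool` body of clause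
codes, each a unary literal-count header and a body of literal codes `⟨binary variable, [polarity]⟩`)
as a flat coded list, computed by a string function in `FP` that is TOTAL (defined and
polynomial-time on every string, not only on codes):

* `Token` (variable, polarity, "opens a clause"), `tokens φ`, the token record
  `tokRec t = ⟨var, ⟨[pol], [first]⟩⟩`;
* **the tokenizer** `tokFn ∈ FP` (`tokFn_mem_FP`): `|z|` rounds of `tokStepB` on a state record
  (`TokSt.enc`), reading the code structure of `z` with the total pair decoder (`fstF`/`sndF`):
  clause by clause (unary clause-count header), literal by literal (unary literal-count header),
  emitting one token record per literal and counting tokens (`1^L`) and clauses (`1^m`); its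
  mathematical mirror is the state machine `TokSt.step` (`tokStepB_enc`, `tokFn_apply`);
  **`toks z`** is the token list read off an arbitrary string `z` (`length_toks_le`: at most `|z|`
  tokens), `clauseCount z` the number of clauses read; the output fields are `nthF_six_tokFn`
  (`1^L`), `nthF_seven_tokFn` (`1^m`), `sndPow_seven_tokFn` (the coded token records);
* **on the code of a CNF** `φ`: `toks (encode φ) = tokensStr φ` (the tokens of `φ` with variables
  renamed into binary numerals, `toks_encode`) and `clauseCount (encode φ) = |φ|`
  (`clauseCount_encode`).

Provenance. This is the tokenizer of
`Literature/Barriers/HubbardSuperconductivity/SignProblemNPHardMachines.lean` (namespace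
`…HubbardSuperconductivity.CNFIsing`, written for the CNF ↦ Ising reduction of the sign-problem
barrier), hoisted VERBATIM into the complexity trunk under `Literature.Computability.Complexity.CNFTok`
so that trunk reductions out of `SAT` (here Karp's 21 problems, `KarpCliqueReduction.lean`) do not
import a barrier file; the barrier copy can be retired onto this one by a librarian pass (its users
are the three `SignProblemNPHard*` proof files).

## References

* R. M. Karp, *Reducibility among combinatorial problems*, in: R. E. Miller, J. W. Thatcher (eds.),
  Complexity of Computer Computations, Plenum 1972, 85–103, §4 (SATISFIABILITY ∝ CLIQUE).
* S. Arora, B. Barak, *Computational Complexity: A Modern Approach*, CUP 2009, §1.3 (polynomial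
  time is closed under composition and polynomially bounded loops), §0.1 (codes of lists).
-/

namespace Literature.Computability.Complexity

open _root_.Computability Brick HashBricks OracleCompose PRelSigma Polynomial
open SProg (dbl dbl_mem_FP length_dbl)

namespace CNFTok

/-! ### Tokens: flattened literal occurrences -/

/-- A literal occurrence of a CNF, flattened: its variable, its polarity, and whether it is the
first literal of its clause. [folklore] -/
structure Token (α : Type) where
  /-- the variable of the literal -/
  var : α
  /-- the polarity (`true` = positive literal) -/
  pol : Bool
  /-- whether the occurrence opens a clause -/
  first : Bool
deriving DecidableEq

variable {α : Type}

/-- The tokens of a clause, the flag of the first one being `b`. [folklore] -/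
def clauseTokens : Bool → Clause α → List (Token α)
  | _, [] => []
  | b, l :: c => ⟨l.1, l.2, b⟩ :: clauseTokens false c

/-- The token list of a CNF: its literal occurrences in order, each clause opened by a flagged
token (empty clauses leave no trace). [folklore] -/
def tokens (φ : CNF α) : List (Token α) :=
  (φ.map (clauseTokens true)).flatten


/-! ### Token records -/

/-- String tokens: tokens whose variable names are bit strings (binary numerals as read off a
CNF code). [folklore] -/
abbrev STok : Type := Token (List Bool)

/-- The record `⟨num, ⟨[pol], [first]⟩⟩` of a string token. [folklore] -/
def tokRec (t : STok) : List Bool :=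
  boolPair t.var (boolPair [t.pol] [t.first])

/-- The first field of a record: the variable name. [folklore] -/
@[simp] theorem fstF_tokRec (t : STok) : fstF (tokRec t) = t.var := by simp [tokRec]

/-- The rest of a record: polarity and clause flag. [folklore] -/
@[simp] theorem sndF_tokRec (t : STok) : sndF (tokRec t) = boolPair [t.pol] [t.first] := by simp [tokRec]

/-- The second field of a record: the polarity bit. [folklore] -/
@[simp] theorem nthF_one_tokRec (t : STok) : nthF 1 (tokRec t) = [t.pol] := by simp [tokRec]

/-- The last field of a record: the clause flag. [folklore] -/
@[simp] theorem sndPow_one_tokRec (t : STok) : sndPow 1 (tokRec t) = [t.first] := by simp [tokRec]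

/-- Length of a record. [folklore] -/
theorem length_tokRec (t : STok) : (tokRec t).length = 2 * t.var.length + 7 := by
  simp [tokRec]

/-- Coded lists are concatenations of framed items. [folklore] -/
theorem body_eq_flatMap (l : List (List Bool)) : body l = l.flatMap fun a => dbl a ++ [false, true] := by
  induction l with
  | nil => rfl
  | cons a l ih => rw [body_cons, List.flatMap_cons, ← ih, boolPair]; simp [dbl, List.append_assoc]

/-- Appending an item to a coded list appends its frame. [folklore] -/
theorem body_append_singleton (l : List (List Bool)) (a : List Bool) :
    body (l ++ [a]) = body l ++ (dbl a ++ [false, true]) := by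
  simp [body_eq_flatMap]


/-! ### The tokenizer: its mathematical model -/

/-- The state of the tokenizer: the rest of the clause-count header, the rest of the clause list,
the rest of the current literal-count header, the rest of the current literal list, the
"next literal opens a clause" flag, the number of tokens, the number of clauses, the tokens.
[folklore] -/
structure TokSt where
  /-- rest of the unary clause-count header -/
  hdr : List Bool
  /-- rest of the coded clause list -/
  bdy : List Bool
  /-- rest of the unary literal-count header of the current clause -/
  khdr : List Bool
  /-- rest of the coded literal list of the current clause -/
  lbody : List Bool
  /-- whether the next literal opens a clause -/
  flag : Bool
  /-- number of tokens emitted -/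
  ell : ℕ
  /-- number of clauses opened -/
  mc : ℕ
  /-- the tokens emitted -/
  toks : List STok

namespace TokSt

/-- The record of a tokenizer state after the ruler `x`:
`⟨x, ⟨hdr, ⟨bdy, ⟨khdr, ⟨lbody, ⟨[flag], ⟨1^ell, ⟨1^mc, body (records)⟩⟩⟩⟩⟩⟩⟩⟩`. [folklore] -/
def enc (x : List Bool) (s : TokSt) : List Bool :=
  boolPair x (boolPair s.hdr (boolPair s.bdy (boolPair s.khdr (boolPair s.lbody (boolPair [s.flag]
    (boolPair (ones s.ell) (boolPair (ones s.mc) (body (s.toks.map tokRec)))))))))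

/-- A literal step: read one literal of the current clause and emit its token. [folklore] -/
def litStep (s : TokSt) : TokSt :=
  { s with
    khdr := s.khdr.tail, lbody := sndF s.lbody, flag := false, ell := s.ell + 1
    toks := s.toks ++ [⟨fstF (fstF s.lbody), (sndF (fstF s.lbody)).headD false, s.flag⟩] }

/-- A clause step: open the next clause. [folklore] -/
def clauseStep (s : TokSt) : TokSt :=
  { s with
    hdr := s.hdr.tail, bdy := sndF s.bdy, khdr := fstF (fstF s.bdy), lbody := sndF (fstF s.bdy)
    flag := true, mc := s.mc + 1 }

/-- One round of the tokenizer: a literal step while the current clause has literals left, else a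
clause step while clauses are left, else nothing. [folklore] -/
def step (s : TokSt) : TokSt :=
  if s.khdr = [] then (if s.hdr = [] then s else s.clauseStep) else s.litStep

/-- The initial state on input `z = ⟨header, clause list⟩`. [folklore] -/
def init (z : List Bool) : TokSt :=
  ⟨fstF z, sndF z, [], [], false, 0, 0, []⟩

/-- The token counter counts the tokens. [folklore] -/
theorem ell_iterate_step (s : TokSt) (h : s.ell = s.toks.length) (n : ℕ) :
    (step^[n] s).ell = (step^[n] s).toks.length := by
  induction n generalizing s with
  | zero => exact h
  | succ n ih =>
    rw [Function.iterate_succ_apply]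
    apply ih
    unfold step
    split_ifs
    · exact h
    · exact h
    · simp [litStep, h]

/-- At most one token per round. [folklore] -/
theorem length_toks_iterate_step_le (s : TokSt) (n : ℕ) :
    (step^[n] s).toks.length ≤ s.toks.length + n := by
  induction n generalizing s with
  | zero => simp
  | succ n ih =>
    rw [Function.iterate_succ_apply]
    refine (ih _).trans ?_
    unfold step
    split_ifs <;> simp [clauseStep, litStep]
    omega

/-- The clause counter grows by at most one per round. [folklore] -/
theorem mc_iterate_step_le (s : TokSt) (n : ℕ) : (step^[n] s).mc ≤ s.mc + n := by
  induction n generalizing s with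
  | zero => simp
  | succ n ih =>
    rw [Function.iterate_succ_apply]
    refine (ih _).trans ?_
    unfold step
    split_ifs <;> simp [clauseStep, litStep]
    omega

end TokSt

/-- **The tokenizer's final state on input `z`**: `|z|` rounds from the initial state. [folklore] -/
def tokState (z : List Bool) : TokSt :=
  TokSt.step^[z.length] (TokSt.init z)

/-- **The string tokens read off an arbitrary input `z`.** [folklore] -/
def toks (z : List Bool) : List STok :=
  (tokState z).toks

/-- The number of clauses read off `z`. [folklore] -/
def clauseCount (z : List Bool) : ℕ :=
  (tokState z).mc

/-- The token counter of the final state is the number of tokens. [folklore] -/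
theorem ell_tokState (z : List Bool) : (tokState z).ell = (toks z).length :=
  TokSt.ell_iterate_step _ rfl _

/-- There are at most `|z|` tokens. [folklore] -/
theorem length_toks_le (z : List Bool) : (toks z).length ≤ z.length := by
  have := TokSt.length_toks_iterate_step_le (TokSt.init z) z.length
  simpa [toks, tokState, TokSt.init] using this

/-- There are at most `|z|` clauses. [folklore] -/
theorem clauseCount_le (z : List Bool) : clauseCount z ≤ z.length := by
  have := TokSt.mc_iterate_step_le (TokSt.init z) z.length
  simpa [clauseCount, tokState, TokSt.init] using this

/-! ### The tokenizer: its bricks -/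

/-- The record of the token read in a literal step, from the state record. [folklore] -/
noncomputable def tokOfB : List Bool → List Bool :=
  fanoutFn (fstF ∘ fstF ∘ nthF 4) (fanoutFn (headBitFn ∘ sndF ∘ fstF ∘ nthF 4) (nthF 5))

/-- The new token field of a literal step: the old coded token list with the new record appended.
[folklore] -/
noncomputable def accB : List Bool → List Bool :=
  concatFn ∘ fanoutFn (sndPow 7) (concatFn ∘ fanoutFn (dbl ∘ tokOfB) fun _ => [false, true])

/-- The last four fields after a literal step. [folklore] -/
noncomputable def litTailB : List Bool → List Bool :=
  fanoutFn (fun _ => [false]) (fanoutFn (List.cons true ∘ nthF 6) (fanoutFn (nthF 7) accB))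

/-- The literal step on state records. [folklore] -/
noncomputable def litB : List Bool → List Bool :=
  fanoutFn (nthF 0) (fanoutFn (nthF 1) (fanoutFn (nthF 2) (fanoutFn (List.tail ∘ nthF 3)
    (fanoutFn (sndF ∘ nthF 4) litTailB))))

/-- The last four fields after a clause step. [folklore] -/
noncomputable def clauseTailB : List Bool → List Bool :=
  fanoutFn (fun _ => [true]) (fanoutFn (nthF 6) (fanoutFn (List.cons true ∘ nthF 7) (sndPow 7)))

/-- The clause step on state records. [folklore] -/
noncomputable def clauseB : List Bool → List Bool :=
  fanoutFn (nthF 0) (fanoutFn (List.tail ∘ nthF 1) (fanoutFn (sndF ∘ nthF 2)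
    (fanoutFn (fstF ∘ fstF ∘ nthF 2) (fanoutFn (sndF ∘ fstF ∘ nthF 2) clauseTailB))))

/-- **One round of the tokenizer on state records.** [folklore] -/
noncomputable def tokStepB : List Bool → List Bool :=
  iteFn (isNilFn ∘ nthF 3) (iteFn (isNilFn ∘ nthF 1) id clauseB) litB

/-- `tokOfB ∈ FP`. [folklore] -/
theorem tokOfB_mem_FP : tokOfB ∈ FP :=
  fanoutFn_mem_FP (comp_mem_FP fstF_mem_FP (comp_mem_FP fstF_mem_FP (nthF_mem_FP 4)))
    (fanoutFn_mem_FP (comp_mem_FP headBitFn_mem_FP (comp_mem_FP sndF_mem_FP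
      (comp_mem_FP fstF_mem_FP (nthF_mem_FP 4)))) (nthF_mem_FP 5))

/-- `accB ∈ FP`. [folklore] -/
theorem accB_mem_FP : accB ∈ FP :=
  comp_mem_FP concatFn_mem_FP (fanoutFn_mem_FP (sndPow_mem_FP 7)
    (comp_mem_FP concatFn_mem_FP (fanoutFn_mem_FP (comp_mem_FP dbl_mem_FP tokOfB_mem_FP) (const_mem_FP _))))

/-- Value of `accB`. [folklore] -/
@[simp] theorem accB_apply (w : List Bool) : accB w = sndPow 7 w ++ (dbl (tokOfB w) ++ [false, true]) := by
  simp [accB]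

/-- `litTailB ∈ FP`. [folklore] -/
theorem litTailB_mem_FP : litTailB ∈ FP :=
  fanoutFn_mem_FP (const_mem_FP _) (fanoutFn_mem_FP (comp_mem_FP (cons_mem_FP true) (nthF_mem_FP 6))
    (fanoutFn_mem_FP (nthF_mem_FP 7) accB_mem_FP))

/-- `litB ∈ FP`. [folklore] -/
theorem litB_mem_FP : litB ∈ FP :=
  fanoutFn_mem_FP (nthF_mem_FP 0) (fanoutFn_mem_FP (nthF_mem_FP 1) (fanoutFn_mem_FP (nthF_mem_FP 2)
    (fanoutFn_mem_FP (comp_mem_FP tail_mem_FP (nthF_mem_FP 3))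
      (fanoutFn_mem_FP (comp_mem_FP sndF_mem_FP (nthF_mem_FP 4)) litTailB_mem_FP))))

/-- `clauseTailB ∈ FP`. [folklore] -/
theorem clauseTailB_mem_FP : clauseTailB ∈ FP :=
  fanoutFn_mem_FP (const_mem_FP _) (fanoutFn_mem_FP (nthF_mem_FP 6)
    (fanoutFn_mem_FP (comp_mem_FP (cons_mem_FP true) (nthF_mem_FP 7)) (sndPow_mem_FP 7)))

/-- `clauseB ∈ FP`. [folklore] -/
theorem clauseB_mem_FP : clauseB ∈ FP :=
  fanoutFn_mem_FP (nthF_mem_FP 0) (fanoutFn_mem_FP (comp_mem_FP tail_mem_FP (nthF_mem_FP 1))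
    (fanoutFn_mem_FP (comp_mem_FP sndF_mem_FP (nthF_mem_FP 2))
      (fanoutFn_mem_FP (comp_mem_FP fstF_mem_FP (comp_mem_FP fstF_mem_FP (nthF_mem_FP 2)))
        (fanoutFn_mem_FP (comp_mem_FP sndF_mem_FP (comp_mem_FP fstF_mem_FP (nthF_mem_FP 2))) clauseTailB_mem_FP))))

/-- `tokStepB ∈ FP`. [folklore] -/
theorem tokStepB_mem_FP : tokStepB ∈ FP :=
  iteFn_mem_FP (comp_mem_FP isNilFn_mem_FP (nthF_mem_FP 3))
    (iteFn_mem_FP (comp_mem_FP isNilFn_mem_FP (nthF_mem_FP 1)) id_mem_FP clauseB_mem_FP) litB_mem_FP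

/-- **The brick round is the model round.** [folklore] -/
theorem tokStepB_enc (x : List Bool) (s : TokSt) : tokStepB (TokSt.enc x s) = TokSt.enc x s.step := by
  have h3 : (isNilFn ∘ nthF 3) (TokSt.enc x s) = [decide (s.khdr = [])] := by simp [TokSt.enc, isNilFn]
  have h1 : (isNilFn ∘ nthF 1) (TokSt.enc x s) = [decide (s.hdr = [])] := by simp [TokSt.enc, isNilFn]
  rw [tokStepB, iteFn_apply h3, TokSt.step]
  by_cases hk : s.khdr = []
  · rw [if_pos (by simp [hk]), iteFn_apply h1, if_pos hk]
    by_cases hh : s.hdr = []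
    · rw [if_pos (by simp [hh]), if_pos hh]; rfl
    · rw [if_neg (by simp [hh]), if_neg hh]
      simp [clauseB, clauseTailB, TokSt.enc, TokSt.clauseStep, ones, List.replicate_succ]
  · rw [if_neg (by simp [hk]), if_neg hk]
    simp [litB, litTailB, tokOfB, TokSt.enc, TokSt.litStep, ones, List.replicate_succ,
      body_append_singleton, tokRec, List.map_append]

/-- Lengths of the fields of a string: four leading fields and the tail fit in the string.
[folklore] -/
theorem length_fields4_le (w : List Bool) :
    2 * ((nthF 0 w).length + (nthF 1 w).length + (nthF 2 w).length + (nthF 3 w).length) +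
      (sndPow 3 w).length ≤ w.length := by
  have h0 : 2 * (nthF 0 w).length + (sndPow 0 w).length ≤ w.length := length_fstF_sndF_le w
  have h1 : 2 * (nthF 1 w).length + (sndPow 1 w).length ≤ (sndPow 0 w).length :=
    length_nthF_succ_add_sndPow_succ_le 0 w
  have h2 : 2 * (nthF 2 w).length + (sndPow 2 w).length ≤ (sndPow 1 w).length :=
    length_nthF_succ_add_sndPow_succ_le 1 w
  have h3 : 2 * (nthF 3 w).length + (sndPow 3 w).length ≤ (sndPow 2 w).length :=
    length_nthF_succ_add_sndPow_succ_le 2 w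
  omega

/-- Lengths of the fields of a string: five leading fields and the tail fit in the string.
[folklore] -/
theorem length_fields5_le (w : List Bool) :
    2 * ((nthF 0 w).length + (nthF 1 w).length + (nthF 2 w).length + (nthF 3 w).length +
      (nthF 4 w).length) + (sndPow 4 w).length ≤ w.length := by
  have h := length_fields4_le w
  have h4 : 2 * (nthF 4 w).length + (sndPow 4 w).length ≤ (sndPow 3 w).length :=
    length_nthF_succ_add_sndPow_succ_le 3 w
  omega

/-- Lengths of the fields of a string: eight leading fields and the tail fit in the string.
[folklore] -/
theorem length_fields8_le (w : List Bool) :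
    2 * ((nthF 0 w).length + (nthF 1 w).length + (nthF 2 w).length + (nthF 3 w).length +
      (nthF 4 w).length + (nthF 5 w).length + (nthF 6 w).length + (nthF 7 w).length) +
        (sndPow 7 w).length ≤ w.length := by
  have h := length_fields5_le w
  have h5 : 2 * (nthF 5 w).length + (sndPow 5 w).length ≤ (sndPow 4 w).length :=
    length_nthF_succ_add_sndPow_succ_le 4 w
  have h6 : 2 * (nthF 6 w).length + (sndPow 6 w).length ≤ (sndPow 5 w).length :=
    length_nthF_succ_add_sndPow_succ_le 5 w
  have h7 : 2 * (nthF 7 w).length + (sndPow 7 w).length ≤ (sndPow 6 w).length :=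
    length_nthF_succ_add_sndPow_succ_le 6 w
  omega

/-- The literal step lengthens no string by more than `60`. [folklore] -/
theorem length_litB_le (w : List Bool) : (litB w).length ≤ w.length + 60 := by
  have h := length_fields8_le w
  have ha := length_fstF_sndF_le (nthF 4 w)
  have hb := length_fstF_sndF_le (fstF (nthF 4 w))
  have hc : ((nthF 3 w).tail).length ≤ (nthF 3 w).length := by simp
  have hd : (headBitFn (sndF (fstF (nthF 4 w)))).length = 1 := by simp
  simp only [litB, litTailB, accB_apply, tokOfB, fanoutFn_apply, length_boolPair, List.length_append, length_dbl,
    Function.comp_apply, List.length_cons, List.length_nil, hd] at *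
  omega

/-- The clause step lengthens no string by more than `60`. [folklore] -/
theorem length_clauseB_le (w : List Bool) : (clauseB w).length ≤ w.length + 60 := by
  have h := length_fields8_le w
  have ha := length_fstF_sndF_le (nthF 2 w)
  have hb := length_fstF_sndF_le (fstF (nthF 2 w))
  have hc : ((nthF 1 w).tail).length ≤ (nthF 1 w).length := by simp
  simp only [clauseB, clauseTailB, fanoutFn_apply, length_boolPair, Function.comp_apply, List.length_cons,
    List.length_nil] at *
  omega

/-- **One tokenizer round lengthens no string by more than `60`.** [folklore] -/
theorem length_tokStepB_le (w : List Bool) : (tokStepB w).length ≤ w.length + 60 := by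
  rw [tokStepB, iteFn_of_oneBit (oneBit_isNilFn.comp _)]
  split_ifs
  · rw [iteFn_of_oneBit (oneBit_isNilFn.comp _)]
    split_ifs
    · simp
    · exact length_clauseB_le w
  · exact length_litB_le w

/-- The initial state record from the input. [folklore] -/
noncomputable def tokInitB : List Bool → List Bool :=
  fanoutFn id (fanoutFn fstF (fanoutFn sndF fun _ =>
    boolPair [] (boolPair [] (boolPair [false] (boolPair [] (boolPair [] []))))))

/-- `tokInitB ∈ FP`. [folklore] -/
theorem tokInitB_mem_FP : tokInitB ∈ FP :=
  fanoutFn_mem_FP id_mem_FP (fanoutFn_mem_FP fstF_mem_FP (fanoutFn_mem_FP sndF_mem_FP (const_mem_FP _)))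

/-- `tokInitB` builds the initial state record. [folklore] -/
theorem tokInitB_apply (z : List Bool) : tokInitB z = TokSt.enc z (TokSt.init z) := by
  simp [tokInitB, TokSt.enc, TokSt.init]

/-- **The tokenizer** as a string function: `|z|` rounds from the initial record. [folklore] -/
noncomputable def tokFn : List Bool → List Bool :=
  (fun w => tokStepB^[(X : Polynomial ℕ).eval (boolUnpair w).1.length] w) ∘ tokInitB

/-- **`tokFn ∈ FP`.** [folklore] -/
theorem tokFn_mem_FP : tokFn ∈ FP :=
  comp_mem_FP (iterate_mem_FP tokStepB_mem_FP 60 length_tokStepB_le X) tokInitB_mem_FP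

/-- Rounds of the brick are rounds of the model. [folklore] -/
theorem iterate_tokStepB_enc (x : List Bool) : ∀ (n : ℕ) (s : TokSt),
    tokStepB^[n] (TokSt.enc x s) = TokSt.enc x (TokSt.step^[n] s)
  | 0, _ => rfl
  | n + 1, s => by
    rw [Function.iterate_succ_apply, tokStepB_enc, iterate_tokStepB_enc x n, ← Function.iterate_succ_apply]

/-- **The tokenizer computes the record of the final state.** [folklore] -/
theorem tokFn_apply (z : List Bool) : tokFn z = TokSt.enc z (tokState z) := by
  simp only [tokFn, Function.comp_apply, tokInitB_apply]
  rw [show (boolUnpair (TokSt.enc z (TokSt.init z))).1 = z by simp [TokSt.enc], eval_X,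
    iterate_tokStepB_enc]
  rfl

/-- The token-count field of the tokenizer output: `1^L`. [folklore] -/
theorem nthF_six_tokFn (z : List Bool) : nthF 6 (tokFn z) = ones (toks z).length := by
  rw [tokFn_apply, ← ell_tokState]; simp [TokSt.enc]

/-- The clause-count field of the tokenizer output: `1^m`. [folklore] -/
theorem nthF_seven_tokFn (z : List Bool) : nthF 7 (tokFn z) = ones (clauseCount z) := by
  rw [tokFn_apply]; simp [TokSt.enc, clauseCount]

/-- The token field of the tokenizer output: the coded list of token records. [folklore] -/
theorem sndPow_seven_tokFn (z : List Bool) : sndPow 7 (tokFn z) = body ((toks z).map tokRec) := by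
  rw [tokFn_apply]; simp [TokSt.enc, toks]


/-- The `listBool` code of a list is the pair of its unary length and the body of the item codes.
[folklore] -/
theorem listBool_encode_eq_boolPair {γ : Type} (e : Encoding γ Bool) (l : List γ) :
    e.listBool.encode l = boolPair (ones l.length) (body (l.map e.encode)) := by
  change boolPair (unaryEncodeNat l.length) (l.foldr (fun a acc => boolPair (e.encode a) acc) []) = _
  rw [OracleCompose.unaryEncodeNat_eq_replicate]
  congr 1
  induction l with
  | nil => rfl
  | cons a l ih => simp [ih]


/-! ### The tokenizer on the code of a CNF -/

section ValidCodes

/-- The code of a literal. [folklore] -/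
theorem encodingLiteral_encode (l : Literal ℕ) : encodingLiteral.encode l = boolPair (encodeNat l.1) [l.2] := rfl

/-- The code of a clause. [folklore] -/
theorem encodingClause_encode (c : Clause ℕ) :
    encodingClause.encode c = boolPair (ones c.length) (body (c.map encodingLiteral.encode)) :=
  listBool_encode_eq_boolPair _ c

/-- The code of a CNF. [folklore] -/
theorem encodingCNF_encode (φ : CNF ℕ) :
    encodingCNF.encode φ = boolPair (ones φ.length) (body (φ.map encodingClause.encode)) :=
  listBool_encode_eq_boolPair _ φ

/-- Renaming a literal's variable into its binary numeral. [folklore] -/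
def strLit (l : Literal ℕ) : Literal (List Bool) :=
  (encodeNat l.1, l.2)

/-- The string tokens of a clause: variable names in binary. [folklore] -/
def clauseTokensStr (b : Bool) (c : Clause ℕ) : List STok :=
  clauseTokens b (c.map strLit)

/-- The string tokens of a CNF: variable names in binary. [folklore] -/
def tokensStr (φ : CNF ℕ) : List STok :=
  tokens (φ.map fun c => c.map strLit)

/-- `tokensStr` clause by clause. [folklore] -/
theorem tokensStr_cons (c : Clause ℕ) (φ : CNF ℕ) : tokensStr (c :: φ) = clauseTokensStr true c ++ tokensStr φ := by
  simp [tokensStr, clauseTokensStr, tokens]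

/-- A clause has as many tokens as literals. [folklore] -/
theorem length_clauseTokens {γ : Type} : ∀ (b : Bool) (c : Clause γ), (clauseTokens b c).length = c.length
  | _, [] => rfl
  | b, _ :: c => by rw [clauseTokens, List.length_cons, length_clauseTokens false c, List.length_cons]

/-- A clause has as many string tokens as literals. [folklore] -/
theorem length_clauseTokensStr (b : Bool) (c : Clause ℕ) : (clauseTokensStr b c).length = c.length := by
  rw [clauseTokensStr, length_clauseTokens, List.length_map]

/-- **The literal rounds of one clause.** From a state whose current clause holds the literals `c`
(`khdr = 1^{|c|}`, `lbody` their coded list), `|c|` rounds emit the tokens of `c` and exhaust the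
clause. [folklore] -/
theorem iterate_step_clause : ∀ (c : Clause ℕ) (hdr bdy : List Bool) (f : Bool) (ell mc : ℕ) (tk : List STok),
    TokSt.step^[c.length] ⟨hdr, bdy, ones c.length, body (c.map encodingLiteral.encode), f, ell, mc, tk⟩ =
      ⟨hdr, bdy, [], [], (c.isEmpty && f), ell + c.length, mc, tk ++ clauseTokensStr f c⟩
  | [], hdr, bdy, f, ell, mc, tk => by simp [clauseTokensStr, clauseTokens]
  | l :: c, hdr, bdy, f, ell, mc, tk => by
    rw [List.length_cons, Function.iterate_succ_apply]
    have h1 : TokSt.step ⟨hdr, bdy, ones (c.length + 1), body ((l :: c).map encodingLiteral.encode), f, ell, mc, tk⟩ =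
        ⟨hdr, bdy, ones c.length, body (c.map encodingLiteral.encode), false, ell + 1, mc,
          tk ++ [⟨encodeNat l.1, l.2, f⟩]⟩ := by
      simp [TokSt.step, ones, List.replicate_succ, TokSt.litStep, encodingLiteral_encode]
    rw [h1, iterate_step_clause c]
    simp [clauseTokensStr, clauseTokens, strLit, List.append_assoc, Nat.add_assoc, Nat.add_comm 1]

/-- The number of tokenizer rounds spent on a clause list: one per clause and one per literal.
[folklore] -/
def roundsOf (φ : CNF ℕ) : ℕ :=
  (φ.map fun c => c.length + 1).sum

/-- The clause-opening flag after a clause list. [folklore] -/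
def flagAfter : Bool → CNF ℕ → Bool
  | f, [] => f
  | _, c :: φ => flagAfter c.isEmpty φ

/-- **The rounds of a clause list.** From a state holding the clause list `φ` (`hdr = 1^{|φ|}`, `bdy`
their coded list, current clause exhausted), `roundsOf φ` rounds emit the tokens of `φ`, count its
clauses and exhaust it. [folklore] -/
theorem iterate_step_cnf : ∀ (φ : CNF ℕ) (f : Bool) (ell mc : ℕ) (tk : List STok),
    TokSt.step^[roundsOf φ] ⟨ones φ.length, body (φ.map encodingClause.encode), [], [], f, ell, mc, tk⟩ =
      ⟨[], [], [], [], flagAfter f φ, ell + (tokensStr φ).length, mc + φ.length, tk ++ tokensStr φ⟩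
  | [], f, ell, mc, tk => by simp [roundsOf, flagAfter, tokensStr, tokens]
  | c :: φ, f, ell, mc, tk => by
    have hr : roundsOf (c :: φ) = (roundsOf φ + c.length) + 1 := by simp [roundsOf]; ring
    rw [hr, Function.iterate_succ_apply, Function.iterate_add_apply]
    have h1 : TokSt.step ⟨ones (φ.length + 1), body ((c :: φ).map encodingClause.encode), [], [], f, ell, mc, tk⟩ =
        ⟨ones φ.length, body (φ.map encodingClause.encode), ones c.length, body (c.map encodingLiteral.encode), true,
          ell, mc + 1, tk⟩ := by
      simp [TokSt.step, ones, List.replicate_succ, TokSt.clauseStep, encodingClause_encode]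
    rw [List.length_cons, h1, iterate_step_clause c, iterate_step_cnf φ]
    simp only [Bool.and_true, flagAfter, tokensStr_cons, List.length_append, length_clauseTokensStr, List.append_assoc,
      TokSt.mk.injEq, and_true, true_and]
    constructor <;> ring

/-- An exhausted tokenizer state is fixed. [folklore] -/
theorem step_exhausted (f : Bool) (ell mc : ℕ) (tk : List STok) :
    TokSt.step ⟨[], [], [], [], f, ell, mc, tk⟩ = ⟨[], [], [], [], f, ell, mc, tk⟩ := by
  simp [TokSt.step]

/-- The code of a CNF is at least as long as the number of tokenizer rounds it needs. [folklore] -/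
theorem roundsOf_le_length_encode (φ : CNF ℕ) : roundsOf φ ≤ (encodingCNF.encode φ).length := by
  rw [encodingCNF_encode, length_boolPair, body_eq_flatMap, List.length_flatMap]
  unfold roundsOf
  have h : ∀ c : Clause ℕ, c.length + 1 ≤ (dbl (encodingClause.encode c) ++ [false, true]).length := by
    intro c
    rw [List.length_append, length_dbl, encodingClause_encode, length_boolPair]
    simp [ones]
    omega
  have := List.sum_le_sum (l := φ) fun c _ => h c
  rw [List.map_map]
  exact this.trans (Nat.le_add_left _ _)

/-- **The tokenizer on the code of a CNF reads off its string tokens …** [folklore] -/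
theorem toks_encode (φ : CNF ℕ) : toks (encodingCNF.encode φ) = tokensStr φ := by
  have hN := roundsOf_le_length_encode φ
  obtain ⟨d, hd⟩ := Nat.exists_eq_add_of_le hN
  have hinit : TokSt.init (encodingCNF.encode φ) = ⟨ones φ.length, body (φ.map encodingClause.encode), [], [], false, 0, 0, []⟩ := by
    simp [TokSt.init, encodingCNF_encode]
  rw [toks, tokState, hd, Nat.add_comm, Function.iterate_add_apply, hinit, iterate_step_cnf,
    Function.iterate_fixed (step_exhausted _ _ _ _)]
  simp

/-- **… and counts its clauses.** [folklore] -/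
theorem clauseCount_encode (φ : CNF ℕ) : clauseCount (encodingCNF.encode φ) = φ.length := by
  have hN := roundsOf_le_length_encode φ
  obtain ⟨d, hd⟩ := Nat.exists_eq_add_of_le hN
  have hinit : TokSt.init (encodingCNF.encode φ) = ⟨ones φ.length, body (φ.map encodingClause.encode), [], [], false, 0, 0, []⟩ := by
    simp [TokSt.init, encodingCNF_encode]
  rw [clauseCount, tokState, hd, Nat.add_comm, Function.iterate_add_apply, hinit, iterate_step_cnf,
    Function.iterate_fixed (step_exhausted _ _ _ _)]
  simp

/-- The string tokens of a CNF are the tokens of the CNF with variables renamed into binary.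
[folklore] -/
theorem tokensStr_eq (φ : CNF ℕ) : tokensStr φ = tokens (φ.map fun c => c.map strLit) := rfl

end ValidCodes

end CNFTok

end Literature.Computability.Complexity
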